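import Literature.NumberTheory.LFunctions.FeketePolyaTablesSequential
import HarnessLib

/-!
# Fekete–Pólya positivity from a table: the sequential kernel check in SEGMENTS (resumable states)

Topic `Literature/NumberTheory/LFunctions`; namespace `Literature.NumberTheory.LFunctions.FeketePolyaTable`
(sequel of `FeketePolyaTablesSequential.lean`). One small computable definition (`seqWalkSt`, the walk
of `seqCheck` returning its final accumulator state) and THEOREMS — no named fact, no `sorry`.

A single `decide +kernel` evaluation of `seqCheck l m k` walks all `m` positions in one declaration;
for a large induced modulus (`χ_{293}` needs `m = 293·1001`, order `k = 8`) this is cut into segments: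
`seqWalkSt l m c n st` processes positions `n+1, …, n+c` from the state `st = (S_1(n), …, S_k(n))`
and returns the state at `n + c` (or `none` if some `S_k` went negative), so that segment theorems
`seqWalkSt l m cᵢ nᵢ stᵢ = some stᵢ₊₁` (each by `decide +kernel`, with the states as explicit integer
literals) chain to the full check by `seqWalk_of_seqWalkSt` / `seqCheck_of_seqWalkSt`, and the
engines of the previous file (`lfunction_ne_zero_of_induced_table_seq`, `good_of_seqCheck`) apply
unchanged.

## References

* H. L. Montgomery, R. C. Vaughan, *Multiplicative Number Theory I*, CUP 2007, §11.2.1 Exercises 7–8.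
  [MontgomeryVaughan2007]
-/

namespace Literature.NumberTheory.LFunctions

namespace FeketePolyaTable

variable (l : List ℤ)

/-- **The resumable walk**: as `seqWalk`, but returning the final accumulator state (`none` as soon as
a last accumulator `S_k` is negative). [cite: MontgomeryVaughan2007, §11.2.1 Exercise 7 (f)] -/
def seqWalkSt (m : ℕ) : ℕ → ℕ → List ℤ → Option (List ℤ)
  | 0, _, st => some st
  | fuel + 1, n, st =>
    let st' := stepAcc st (indVal l m (n + 1))
    match st'.getLastD 0 with
    | Int.negSucc _ => none
    | Int.ofNat _ =>
      match n + 1 with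
      | 0 => none
      | n' + 1 => seqWalkSt m fuel (n' + 1) st'

/-- One step of `seqWalk`, as an equivalence. [folklore] -/
private theorem seqWalk_succ_iff (m fuel n : ℕ) (st : List ℤ) :
    seqWalk l m (fuel + 1) n st = true ↔
      0 ≤ (stepAcc st (indVal l m (n + 1))).getLastD 0 ∧
        seqWalk l m fuel (n + 1) (stepAcc st (indVal l m (n + 1))) = true := by
  rw [seqWalk]
  simp only
  generalize (stepAcc st (indVal l m (n + 1))).getLastD 0 = z
  cases z with
  | negSucc a =>
    constructor
    · intro h; exact absurd h Bool.false_ne_true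
    · rintro ⟨h, -⟩; exact absurd h (by simp)
  | ofNat a => exact ⟨fun h ↦ ⟨Int.natCast_nonneg a, h⟩, fun h ↦ h.2⟩

/-- One step of `seqWalkSt`. [folklore] -/
private theorem seqWalkSt_succ (m fuel n : ℕ) (st st'' : List ℤ)
    (h : seqWalkSt l m (fuel + 1) n st = some st'') :
    0 ≤ (stepAcc st (indVal l m (n + 1))).getLastD 0 ∧
      seqWalkSt l m fuel (n + 1) (stepAcc st (indVal l m (n + 1))) = some st'' := by
  rw [seqWalkSt] at h
  simp only at h
  generalize hz : (stepAcc st (indVal l m (n + 1))).getLastD 0 = z at h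
  cases z with
  | negSucc a => exact absurd h (by simp)
  | ofNat a => exact ⟨Int.natCast_nonneg a, h⟩

/-- **Chaining a segment**: if the walk over `a` positions from `(n, st)` ends in the state `st'` and the
check over the next `b` positions from `(n + a, st')` succeeds, then the check over `a + b` positions from
`(n, st)` succeeds. [cite: MontgomeryVaughan2007, §11.2.1 Exercise 7 (f)] -/
theorem seqWalk_of_seqWalkSt (m : ℕ) : ∀ (a n : ℕ) (st st' : List ℤ) {b : ℕ},
    seqWalkSt l m a n st = some st' → seqWalk l m b (n + a) st' = true →
      seqWalk l m (a + b) n st = true := by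
  intro a
  induction a with
  | zero =>
    intro n st st' b h1 h2
    rw [seqWalkSt] at h1
    cases h1
    simpa using h2
  | succ a ih =>
    intro n st st' b h1 h2
    obtain ⟨h0, h1'⟩ := seqWalkSt_succ l m a n st st' h1
    rw [show a + 1 + b = (a + b) + 1 by omega, seqWalk_succ_iff]
    refine ⟨h0, ih (n + 1) _ st' h1' ?_⟩
    rwa [show n + 1 + a = n + (a + 1) by omega]

/-- **Two segments make a check**: `seqWalkSt l m a 0 (replicate k 0) = some st₁` and
`seqWalk l m b a st₁ = true` with `a + b = m` give `seqCheck l m k = true`.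
[cite: MontgomeryVaughan2007, §11.2.1 Exercise 7 (f)] -/
theorem seqCheck_of_seqWalkSt {m k a b : ℕ} {st₁ : List ℤ} (hab : a + b = m)
    (h1 : seqWalkSt l m a 0 (List.replicate k 0) = some st₁) (h2 : seqWalk l m b a st₁ = true) :
    seqCheck l m k = true := by
  subst hab
  rw [seqCheck]
  exact seqWalk_of_seqWalkSt l (a + b) a 0 _ st₁ h1 (by rwa [Nat.zero_add])

/-- **Chaining two resumable segments** (for walks cut into more than two pieces):
`seqWalkSt a n st = some st'` and `seqWalkSt b (n + a) st' = some st''` give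
`seqWalkSt (a + b) n st = some st''`. [cite: MontgomeryVaughan2007, §11.2.1 Exercise 7 (f)] -/
theorem seqWalkSt_append (m : ℕ) : ∀ (a n : ℕ) (st st' st'' : List ℤ) {b : ℕ},
    seqWalkSt l m a n st = some st' → seqWalkSt l m b (n + a) st' = some st'' →
      seqWalkSt l m (a + b) n st = some st'' := by
  intro a
  induction a with
  | zero =>
    intro n st st' st'' b h1 h2
    rw [seqWalkSt] at h1
    cases h1
    simpa using h2
  | succ a ih =>
    intro n st st' st'' b h1 h2
    obtain ⟨h0, h1'⟩ := seqWalkSt_succ l m a n st st' h1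
    rw [show a + 1 + b = (a + b) + 1 by omega, seqWalkSt]
    simp only
    generalize hz : (stepAcc st (indVal l m (n + 1))).getLastD 0 = z
    rw [hz] at h0
    cases z with
    | negSucc c => exact absurd h0 (by simp)
    | ofNat c =>
      simp only
      exact ih (n + 1) _ st' st'' h1' (by rwa [show n + 1 + a = n + (a + 1) by omega])

end FeketePolyaTable

end Literature.NumberTheory.LFunctions
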